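import Literature.Computability.Complexity.CircuitComposition
import Literature.Computability.Complexity.CircuitSizeProofs
import Literature.Computability.MetaComplexity.TruthTables
import HarnessLib

/-!
# Truth tables: every Boolean function has a `B₂`-circuit (proofs for `TruthTables.lean`)

This file DISCHARGES (D-0014) the two named facts of
`Literature.Computability.MetaComplexity.TruthTables`:

* `exists_computes_B2_holds` — every `f : (Fin n → Bool) → Bool`, the case `n = 0` included, is
  computed by a circuit over the full fan-in-`2` basis `B2`;
* `exists_computes_B2_size_eq_holds` — hence the infimum `circuitSizeOver B2 f` of the sizes of
  such circuits is attained: some `B₂`-circuit computing `f` has size exactly `circuitSizeOver B2 f`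
  (the circuit complexity of `f` over `B₂` is a genuine minimum, never the `sInf` junk value).

The printed argument (Jukna 2012, §1.1–§1.2): every Boolean function of `n` variables has a DNF,
equivalently a circuit obtained from the recurrence (1.1)
`f(x₁,…,xₙ₊₁) = xₙ₊₁ ∧ f(x₁,…,xₙ,1) ∨ ¬xₙ₊₁ ∧ f(x₁,…,xₙ,0)` (Shannon expansion; §1.1, "CNFs and
DNFs"), so the set of sizes of circuits computing `f` is a nonempty set of natural numbers and the
circuit complexity of `f`, "the minimum size of a circuit computing `f`" (§1.2; Def. 1.11 in §1.4,
where also "`C(n) = O(n2ⁿ)`: just take the DNFs", §1.4.1), is a minimum that is attained. In the tree the recurrence (1.1) over `B₂` is `cktSize_univ_fin`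
(`CircuitComposition.lean`; size `≤ univBound n = 5 · 2ⁿ - 4`, the case `n = 0` being a single
constant gate), `CktSize.toCircuit` extracts a genuine `Circuit (Fin n)` over `B2`, and
`exists_circuit_size_eq_circuitSizeOver` (`CircuitSizeProofs.lean`) is the `Nat.sInf_mem` step.

Nothing else is here: the sharp Shannon–Lupanov bounds `C(f) ≤ (1 + o(1)) 2ⁿ/n` (Jukna 2012,
Thm. 1.15) are not needed for attainment and are not formalized in this file.

## References

* S. Jukna, *Boolean Function Complexity: Advances and Frontiers*, Springer 2012 (Algorithms and
  Combinatorics 27), §1.1 eq. (1.1) (every function has a DNF / Shannon expansion), §1.2 (circuits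
  as straight-line programs; size = number of gates), §1.4 Def. 1.11 (`μ(f)` = the minimum size of
  a circuit computing `f`) and §1.4.1 ("`C(n) = O(n2ⁿ)`: just take the DNFs") [Jukna2012].
* S. Arora, B. Barak, *Computational Complexity: A Modern Approach*, CUP 2009, Claim 2.13 (every
  function has a CNF/DNF, hence a circuit) [AroraBarakCC2009].
-/

namespace Literature.Computability.MetaComplexity

open Complexity

variable {n : ℕ}

/-- Every Boolean function `f` on `n` variables (any `n`, including `n = 0`) is computed by a
`B₂`-circuit with at most `univBound n = 5 · 2ⁿ - 4` gates, by the DNF / Shannon-expansion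
recurrence `f = xₙ₊₁ ∧ f|₁ ∨ ¬xₙ₊₁ ∧ f|₀` (Jukna 2012, §1.1, eq. (1.1); Arora–Barak 2009,
Claim 2.13; the tree's `cktSize_univ_fin` and `CktSize.toCircuit`). [cite: Jukna2012, §1.1 eq. (1.1)] -/
theorem exists_computes_B2_size_le (f : (Fin n → Bool) → Bool) :
    ∃ C : Circuit (Fin n), C.IsOver B2 ∧ C.Computes f ∧ C.size ≤ univBound n := by
  obtain ⟨C, hB, hs, hC⟩ :=
    (cktSize_univ_fin n fun (x : Fin n → Bool) (_ : Unit) => f x).toCircuit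
  exact ⟨C, hB, hC, hs⟩

/-- **Discharge of `exists_computes_B2`** (`TruthTables.lean`): every Boolean function on `n`
variables, `n = 0` included, is computed by some circuit over the full binary basis `B₂`
(Jukna 2012, §1.1 eq. (1.1) and §1.2). [cite: Jukna2012, §1.2] -/
theorem exists_computes_B2_holds : exists_computes_B2 (n := n) := by
  intro f
  obtain ⟨C, hB, hC, -⟩ := exists_computes_B2_size_le f
  exact ⟨C, hB, hC⟩

/-- **Discharge of `exists_computes_B2_size_eq`** (`TruthTables.lean`): the circuit complexity
`circuitSizeOver B2 f` is attained by a `B₂`-circuit computing `f` — the set of sizes of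
`B₂`-circuits computing `f` is nonempty (`exists_computes_B2_holds`), so its infimum in `ℕ` is a
minimum (Jukna 2012, §1.2 and Def. 1.11: "`μ(f)` is the minimum size of a circuit computing `f`").
[cite: Jukna2012, §1.2 and Def. 1.11] -/
theorem exists_computes_B2_size_eq_holds : exists_computes_B2_size_eq (n := n) := by
  intro f
  exact exists_circuit_size_eq_circuitSizeOver (exists_computes_B2_holds f)

end Literature.Computability.MetaComplexity
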